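import Summits.CriticalPhenomena.PercolationContinuityZ3.Theorems.PercNearOneGluingNoHeavyPcintWinKernelSymCert
import Summits.CriticalPhenomena.PercolationContinuityZ3.Theorems.PercNearOneGluingNoHeavyPcintWinKernelRange
import HarnessLib

/-!
# PCINT lane, kernel B2r window certificate `d = 4`, memory 6 (5-step windows, 32768 codes) — table and chunk check

Cell `prim-pcint`, seat `prim-pcint-2` (gen 2); memo `run/shared/lean/prim/pcint/REDUCTIONS.md` §B2r, INTERVAL-PLAN §14.
Does NOT build on p205010.  Instance data for the generic theorem
`WinK.le_siteCriticalProb_of_checkSK`: `p = 1666/10^4`, `q̄ = 9744/10^4` (`q̄^7 ≥ 1-p`), `κ̄ = (10^4+9744)/(2·10^4)`; Collatz–Wielandt vector on the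
70 hyperoctahedral normal forms keyed by the Gram code of the window (integer scale `10^5`, found by power iteration and verified in exact arithmetic
off-line: max row ratio `732497717/732625000` < 1; `λ = 99999/10^5`).  The `32768` coded rows are checked (only on first-use normal forms, WinK.isNF) by `decide +kernel` in
`…KernZ4S6Check*`; result in `…KernZ4S6`: `p_c^site(ℤ⁴) ≥ 0.1666`.
-/

namespace Summit.CriticalPhenomena.PercolationContinuityZ3.Theorems.Pcint

namespace Z4S6

set_option maxRecDepth 4000 in
/-- Certificate table, chunk 1/1 (`Gram code ↦ v`). [folklore] -/
def tbl1 : List (ℕ × ℕ) := [(282817489387, 81815), (282817548199, 81815), (282817668475, 81948), (282817727779, 81948), (282831838075, 81815), (282832017409, 81948), (282846187009, 81024), (282846366343, 81665), (282860542423, 82079), (282860601481, 82079), (282874891603, 82079), (282948223627, 84390), (282948223873, 84390), (282962631619, 84390), (282991456243, 84436), (283005864481, 84436), (286304273623, 81815), (286304452957, 81948), (286347326905, 82079), (286435008109, 84390), (286478240725, 84436), (289791058105, 80860), (289791237439, 81665), (289834111387, 82079), (289921792591, 84046), (289965025207, 84436), (293277862027, 82079), (293277921085, 82079), (293292210961,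 82079), (293306559895, 82079), (293408596513, 84436), (293423004505, 84436), (296764646755, 82079), (296895381241, 84436), (303738234913, 69818), (303738293971, 70492), (303752583847, 70492), (303868969399, 83849), (303883377391, 84192), (310711804123, 69660), (310842538609, 83769), (314203331719, 84534), (314203331965, 84534), (314217680653, 84534), (314232029587, 84359), (314246385001, 84534), (314260734181, 84534), (317690175259, 84534), (317733228541, 84534), (324663883939, 84534), (324678232873, 84534), (324692581807, 84534), (328150727725, 84534), (378122929435, 99637), (378122929681, 99637), (378122988493, 99637), (378123108769, 99681), (378123168073, 99681), (381624062851, 99637), (381624242185, 99681), (385125196267, 98760), (385125375601, 99333), (388626355603, 99750), (388626414661, 99750), (392127489265, 99750), (409639506499, 100000), (409639506745, 100000), (413140698973, 100000), (420143112001, 100000), (423644304721, 100000)]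


/-- The certificate table `Gram code ↦ v` (concatenation of the chunks). [folklore] -/
def tbl : List (ℕ × ℕ) := tbl1

/-- All table values lie in `[69660, 100000]`. [folklore] -/
theorem tbl_bounds : ∀ e ∈ tbl, 69660 ≤ e.2 ∧ e.2 ≤ 100000 := by decide +kernel

/-- The Collatz–Wielandt row check on the window codes `[lo, hi)`. [folklore] -/
def chk (lo hi : ℕ) : Bool := WinK.allRange (WinK.nfOKS 4 4 1666 9744 99999 tbl 69660) lo hi

/-- Splitting a chunk check. [folklore] -/
theorem chk_split {lo mid hi : ℕ} (h1 : chk lo mid = true) (h2 : chk mid hi = true) : chk lo hi = true :=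
  WinK.allRange_split h1 h2

end Z4S6

end Summit.CriticalPhenomena.PercolationContinuityZ3.Theorems.Pcint
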